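import Summits.QuantumFields.YangMills.Theses.LangevinControlUV
import Summits.QuantumFields.YangMills.Theorems.FemtoCurvatureTwoPoint.Negative.UnfaithfulFalseSU

/-!
# `FemtoCurvatureTwoPointC` — running is load-bearing: the C′ crux is incompatible with ANY
# `n`-uniform freezing rate of the diagonal femto amplitudes (in particular the Gaussian `β⁻²` law)

Negative lemma for crux `Summit.QuantumFields.YangMills.Theses.LangevinControlUV.
FemtoCurvatureTwoPointC` (item stmt-QuantumFields-16204; cdisprove cycle 1, importable extract of
`§ Running` of the crux workfile
`Summits/QuantumFields/YangMills/Cruxes/FemtoCurvatureTwoPointC/Disproof.lean`).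

The C′ crux is the typed item `FemtoCurvatureTwoPoint` (stmt-9363) with ONE token added,
`Continuous a`. This file records, kernel-checked, what that token makes load-bearing.

* `exists_ge_level`, `tendsto_atTop_of_levels` (analysis) — a continuous positive unit map `a → 0`
  attains every small level `s/(m+1)` beyond any base point, at couplings that DIVERGE with `m`.
* `false_of_uniformFreezing` (abstract core) — for ANY array of "amplitudes" `A m β`: the crux's
  lower-bound shape `c · Γ((m+1) a(β)) ≤ A m β` on the femto diagonal (`8(m+1) a(β) ≤ ℓ₀`,
  `β ≥ β₀`), with `a` continuous, `Γ > 0` on `(0, ℓ₀]`, is INCOMPATIBLE with an `m`-uniform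
  freezing rate `A m β ≤ φ(β) → 0` (`β ≥ β₁`): along the RG chain `(m+1) a(β_m) = s` the left side
  is the fixed positive number `c Γ(s)` while `β_m → ∞`.
* `lowerBoundC_false_of_uniformFreezing` — the same for the crux's own amplitudes
  `A m β = (m+1)⁸ Cov_{8(m+1),β}(P_0^{01}, P_{(m+1)e₂}^{01})` and the crux's own lower-bound clause
  (every `G`, every `ρ`: nothing about Wilson's measure is used).
* `femtoCurvatureTwoPointC_false_of_uniformFreezing` (template) — ONE compact simple Lie `G` and
  ONE faithful `r` whose diagonal femto amplitudes freeze at an `m`-uniform rate refute the crux;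
  `femtoCurvatureTwoPointC_false_of_bareLaw_su` — in particular the bare-coupling law
  `(m+1)⁸ Cov ≤ K β⁻²` (covariance = (bare coupling)² × kernel², NO running — the law of every
  free / abelian lattice gauge field) for one faithful `r` of one `SU(n)` refutes it.

Reading. For the typed item the template is EMPTY: a generic STEP unit map decouples all
`(β, n)` and compact `U(1)` (free Maxwell around torons, `β⁻²` law) passes the typed body
(`Cruxes/FemtoCurvatureTwoPoint/CDISPROVE-gen2-verdict.md`). For C′ it is the dividing line
between a Gaussian fixed point and asymptotic freedom: any proof of C′ must exhibit amplitudes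
that are UNBOUNDED in units of the bare coupling squared along the chains
(`β_m² · (m+1)⁸ Cov_{8(m+1),β_m}(m+1) → ∞`), i.e. must use running. For `SU(N)` RG-improved
perturbation theory gives `(m+1)⁸ Cov ≈ κ/(β/2 − 2b₀ log(m+1) + …)²`, not uniformly small in `m`,
so no kill of the crux follows — the hypothesis is false exactly where it should be.
-/

noncomputable section

open Filter Topology MeasureTheory Set
open Literature.MathematicalPhysics.QuantumFieldTheory Literature.MathematicalPhysics.QuantumLattice
open Summit.QuantumFields.YangMills.Theses.LangevinControlUV (FemtoCurvatureTwoPointC)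
open Summit.QuantumFields.YangMills.Theorems.FemtoCurvatureTwoPoint.Negative.UnfaithfulFalseSU
  (isCompactSimpleLieGroup_su)

namespace Summit.QuantumFields.YangMills.Theorems.FemtoCurvatureTwoPointC.Negative.UniformFreezing

/-! ## Analysis: levels of a continuous unit map -/

/-- **Levels are attained beyond any base point.** If `a` is continuous and tends to `0`, every
level `t ∈ (0, a(B)]` is attained at some `β ≥ B`. -/
theorem exists_ge_level {a : ℝ → ℝ} (hcont : Continuous a) (hat : Tendsto a atTop (𝓝 0))
    {B t : ℝ} (ht0 : 0 < t) (ht : t ≤ a B) : ∃ β : ℝ, B ≤ β ∧ a β = t := by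
  obtain ⟨B', hB't, hBB'⟩ := ((hat.eventually (Iio_mem_nhds ht0)).and (eventually_ge_atTop B)).exists
  obtain ⟨x, hx, hxt⟩ :=
    intermediate_value_Icc' hBB' hcont.continuousOn ⟨le_of_lt hB't, ht⟩
  exact ⟨x, hx.1, hxt⟩

/-- **Level couplings diverge.** If `a` is continuous and positive and `β_m ≥ B` solve
`(m+1) · a(β_m) = s` for all `m`, then `β_m → ∞`: on every compact `[B, M]` the unit map has a
positive minimum, below which `s/(m+1)` eventually falls. (Dimensional transmutation is forced:
the couplings at which the tori `8(m+1)` reach a fixed level diverge.) -/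
theorem tendsto_atTop_of_levels {a : ℝ → ℝ} (hcont : Continuous a) (ha : ∀ β, 0 < a β)
    {B s : ℝ} {βs : ℕ → ℝ} (hB : ∀ m : ℕ, B ≤ βs m)
    (hlev : ∀ m : ℕ, ((m + 1 : ℕ) : ℝ) * a (βs m) = s) : Tendsto βs atTop atTop := by
  refine tendsto_atTop.2 fun M => ?_
  obtain ⟨x, -, hmin⟩ :=
    isCompact_Icc.exists_isMinOn (nonempty_Icc.2 (le_max_left B M)) hcont.continuousOn
  have hm0 : 0 < a x := ha x
  obtain ⟨n₀, hn₀⟩ := exists_nat_gt (s / a x)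
  refine eventually_atTop.2 ⟨n₀, fun m hm => ?_⟩
  have hnpos : (0 : ℝ) < ((m + 1 : ℕ) : ℝ) := by positivity
  have hsmall : a (βs m) < a x := by
    have h1 : a (βs m) = s / ((m + 1 : ℕ) : ℝ) := by
      rw [eq_div_iff hnpos.ne', mul_comm]; exact hlev m
    have h2 : s / a x < ((m + 1 : ℕ) : ℝ) :=
      lt_of_lt_of_le hn₀ (by exact_mod_cast hm.trans (Nat.le_succ m))
    rw [h1, div_lt_iff₀ hnpos]
    rw [div_lt_iff₀ hm0] at h2
    linarith
  by_contra hM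
  exact absurd (hmin (⟨hB m, (not_le.1 hM).le.trans (le_max_right B M)⟩ : βs m ∈ Icc B (max B M)))
    (not_le.2 hsmall)

/-! ## Abstract core: a continuous-unit-map lower bound versus a uniform freezing rate -/

/-- **Core contradiction.** Let `A m β` be any array of numbers ("the amplitude at separation `m+1`
on the torus `8(m+1)` at coupling `β`"). If a CONTINUOUS positive `a → 0`, a shape `Γ > 0` on
`(0, ℓ₀]` and `c > 0` satisfy the crux's lower-bound shape on the femto diagonal,
`c · Γ((m+1) a(β)) ≤ A m β` whenever `β ≥ β₀` and `8 (m+1) a(β) ≤ ℓ₀`, then NO `m`-uniform rate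
`φ(β) → 0` bounds `A m β` for all `m` and all `β ≥ β₁`. -/
theorem false_of_uniformFreezing {A : ℕ → ℝ → ℝ} {a Γ φ : ℝ → ℝ} {β₀ β₁ ℓ₀ c : ℝ}
    (hcont : Continuous a) (ha : ∀ β, 0 < a β) (hat : Tendsto a atTop (𝓝 0)) (hℓ : 0 < ℓ₀)
    (hc : 0 < c) (hΓ : ∀ s : ℝ, 0 < s → s ≤ ℓ₀ → 0 < Γ s)
    (hlow : ∀ (m : ℕ) (β : ℝ), β₀ ≤ β → 8 * (((m + 1 : ℕ) : ℝ) * a β) ≤ ℓ₀ →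
      c * Γ (((m + 1 : ℕ) : ℝ) * a β) ≤ A m β)
    (hφ : Tendsto φ atTop (𝓝 0)) (hU : ∀ (m : ℕ) (β : ℝ), β₁ ≤ β → A m β ≤ φ β) : False := by
  -- base point and level
  set B : ℝ := max β₀ β₁ with hB_def
  set s : ℝ := min (a B / 2) (ℓ₀ / 8) with hs_def
  have hs0 : 0 < s := lt_min (half_pos (ha B)) (by linarith)
  have hsB : s ≤ a B := (min_le_left _ _).trans (half_le_self (ha B).le)
  have hsℓ : 8 * s ≤ ℓ₀ := by
    have := min_le_right (a B / 2) (ℓ₀ / 8); linarith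
  have hε : 0 < c * Γ s := mul_pos hc (hΓ s hs0 (by linarith))
  -- beyond `B'` the uniform rate is below the chain level
  obtain ⟨B', hB'⟩ := eventually_atTop.1 (hφ.eventually (Iio_mem_nhds hε))
  -- positive minimum of `a` on `[B, max B B']`
  obtain ⟨x, -, hmin⟩ :=
    isCompact_Icc.exists_isMinOn (nonempty_Icc.2 (le_max_left B B')) hcont.continuousOn
  have hm0 : 0 < a x := ha x
  -- an index `m` with `s / (m+1) < a x`
  obtain ⟨m, hm⟩ := exists_nat_gt (s / a x)
  have hnpos : (0 : ℝ) < ((m + 1 : ℕ) : ℝ) := by positivity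
  -- the level `s/(m+1)` is attained at some `β ≥ B`
  have hlev : s / ((m + 1 : ℕ) : ℝ) ≤ a B :=
    (div_le_self hs0.le (by exact_mod_cast Nat.succ_le_succ (Nat.zero_le m))).trans hsB
  obtain ⟨β, hBβ, hβs⟩ := exists_ge_level hcont hat (div_pos hs0 hnpos) hlev
  have harg : ((m + 1 : ℕ) : ℝ) * a β = s := by rw [hβs]; field_simp
  -- lower bound at `(m, β)` versus the uniform rate
  have h1 : c * Γ s ≤ A m β := by
    have := hlow m β ((le_max_left _ _).trans hBβ) (by rw [harg]; exact hsℓ)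
    rwa [harg] at this
  have h2 : A m β ≤ φ β := hU m β ((le_max_right _ _).trans hBβ)
  -- hence `β < B'`, so `β ∈ [B, max B B']` and `a β ≥ a x`
  have hβB' : β ≤ max B B' := by
    refine le_trans ?_ (le_max_right B B')
    by_contra hlt
    exact absurd (hB' β (not_le.1 hlt).le) (not_lt.2 (h1.trans h2))
  have hax : a x ≤ a β := hmin (⟨hBβ, hβB'⟩ : β ∈ Icc B (max B B'))
  -- but `a β = s/(m+1) < a x`
  have h3 : s < ((m + 1 : ℕ) : ℝ) * a x := by
    have : s / a x < ((m + 1 : ℕ) : ℝ) := lt_of_lt_of_le hm (by exact_mod_cast Nat.le_succ m)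
    rwa [div_lt_iff₀ hm0] at this
  nlinarith

/-! ## The crux's own amplitudes and lower-bound clause -/

variable {G : Type} [Group G] [TopologicalSpace G] [IsTopologicalGroup G] [CompactSpace G]

section Rho

variable [MeasurableSpace G] [BorelSpace G] {N : ℕ} (ρ : G →* Matrix (Fin N) (Fin N) ℂ)

/-- **The C′ lower bound is incompatible with uniform diagonal freezing** — for EVERY group and
EVERY `ρ` (nothing about Wilson's measure enters). Data: a continuous unit map `a > 0`, `a → 0`,
`ℓ₀, c > 0`, `Γ > 0` on `(0, ℓ₀]`, the crux's lower-bound clause on femto tori (verbatim), and an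
`m`-uniform rate `φ → 0` with `(m+1)⁸ Cov_{8(m+1),β}(P_0^{01}, P_{(m+1)e₂}^{01}) ≤ φ(β)` for all
`m` and `β ≥ β₁`. -/
theorem lowerBoundC_false_of_uniformFreezing {a Γ φ : ℝ → ℝ} {β₀ β₁ ℓ₀ c : ℝ}
    (hcont : Continuous a) (ha : ∀ β, 0 < a β) (hat : Tendsto a atTop (𝓝 0)) (hℓ : 0 < ℓ₀)
    (hc : 0 < c) (hΓ : ∀ s : ℝ, 0 < s → s ≤ ℓ₀ → 0 < Γ s)
    (hlow : ∀ (L : ℕ) [NeZero L] (β : ℝ), β₀ ≤ β → (L : ℝ) * a β ≤ ℓ₀ →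
      ∀ n : ℕ, 1 ≤ n → 8 * n ≤ L →
        c * Γ ((n : ℝ) * a β) ≤ (n : ℝ) ^ 8 *
          (wilsonExpectation (d := 4) (L := L) ρ β (fun U =>
              ((N : ℝ) - (ρ (plaquetteHolonomy U (0 : Site 4 L) 0 1)).trace.re) *
                ((N : ℝ) - (ρ (plaquetteHolonomy U (Pi.single (2 : Fin 4) ((n : ℕ) : ZMod L))
                  0 1)).trace.re)) -
            wilsonExpectation (d := 4) (L := L) ρ β
                (fun U => (N : ℝ) - (ρ (plaquetteHolonomy U (0 : Site 4 L) 0 1)).trace.re) *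
              wilsonExpectation (d := 4) (L := L) ρ β (fun U => (N : ℝ) -
                (ρ (plaquetteHolonomy U (Pi.single (2 : Fin 4) ((n : ℕ) : ZMod L)) 0 1)).trace.re)))
    (hφ : Tendsto φ atTop (𝓝 0))
    (hU : ∀ (m : ℕ) (β : ℝ), β₁ ≤ β →
      ((m + 1 : ℕ) : ℝ) ^ 8 *
          (wilsonExpectation (d := 4) (L := 8 * (m + 1)) ρ β (fun U =>
              ((N : ℝ) - (ρ (plaquetteHolonomy U (0 : Site 4 (8 * (m + 1))) 0 1)).trace.re) *
                ((N : ℝ) - (ρ (plaquetteHolonomy U (Pi.single (2 : Fin 4)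
                  (((m + 1 : ℕ) : ℕ) : ZMod (8 * (m + 1)))) 0 1)).trace.re)) -
            wilsonExpectation (d := 4) (L := 8 * (m + 1)) ρ β
                (fun U => (N : ℝ) - (ρ (plaquetteHolonomy U (0 : Site 4 (8 * (m + 1))) 0 1)).trace.re) *
              wilsonExpectation (d := 4) (L := 8 * (m + 1)) ρ β (fun U => (N : ℝ) -
                (ρ (plaquetteHolonomy U (Pi.single (2 : Fin 4)
                  (((m + 1 : ℕ) : ℕ) : ZMod (8 * (m + 1)))) 0 1)).trace.re)) ≤ φ β) :
    False := by
  refine false_of_uniformFreezing (β₀ := β₀) hcont ha hat hℓ hc hΓ (fun m β hβ hfem => ?_) hφ hU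
  have hfem' : ((8 * (m + 1) : ℕ) : ℝ) * a β ≤ ℓ₀ := by push_cast at hfem ⊢; linarith
  exact hlow (8 * (m + 1)) β hβ hfem' (m + 1) (Nat.succ_le_succ (Nat.zero_le m)) le_rfl

end Rho

/-- **Refutation template for the crux.** If for ONE compact simple Lie `G` and ONE faithful `r`
the diagonal femto amplitudes `(m+1)⁸ Cov_{8(m+1),β}(P_0^{01}, P_{(m+1)e₂}^{01})` freeze at an
`m`-UNIFORM rate `φ(β) → 0` (`β ≥ β₁`), then `FemtoCurvatureTwoPointC` is false. -/
theorem femtoCurvatureTwoPointC_false_of_uniformFreezing (hG : IsCompactSimpleLieGroup G)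
    (r : LatticeRep G) {φ : ℝ → ℝ} (hφ : Tendsto φ atTop (𝓝 0)) {β₁ : ℝ}
    (hU : letI : MeasurableSpace G := borel G
      haveI : BorelSpace G := ⟨rfl⟩
      ∀ (m : ℕ) (β : ℝ), β₁ ≤ β →
        ((m + 1 : ℕ) : ℝ) ^ 8 *
          (wilsonExpectation (d := 4) (L := 8 * (m + 1)) r.ρ β (fun U =>
              ((r.N : ℝ) - (r.ρ (plaquetteHolonomy U (0 : Site 4 (8 * (m + 1))) 0 1)).trace.re) *
                ((r.N : ℝ) - (r.ρ (plaquetteHolonomy U (Pi.single (2 : Fin 4)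
                  (((m + 1 : ℕ) : ℕ) : ZMod (8 * (m + 1)))) 0 1)).trace.re)) -
            wilsonExpectation (d := 4) (L := 8 * (m + 1)) r.ρ β (fun U =>
                (r.N : ℝ) - (r.ρ (plaquetteHolonomy U (0 : Site 4 (8 * (m + 1))) 0 1)).trace.re) *
              wilsonExpectation (d := 4) (L := 8 * (m + 1)) r.ρ β (fun U => (r.N : ℝ) -
                (r.ρ (plaquetteHolonomy U (Pi.single (2 : Fin 4)
                  (((m + 1 : ℕ) : ℕ) : ZMod (8 * (m + 1)))) 0 1)).trace.re)) ≤ φ β) :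
    ¬ FemtoCurvatureTwoPointC := by
  intro hC
  letI : MeasurableSpace G := borel G
  haveI : BorelSpace G := ⟨rfl⟩
  obtain ⟨a, hcont, Γ, β₀, ℓ₀, c, C, hℓ, hc, ha, hat, hΓ, hcl⟩ := hC G hG r
  exact lowerBoundC_false_of_uniformFreezing r.ρ hcont ha hat hℓ hc (fun s hs hs' => (hΓ s hs hs').1)
    (fun L _ β hβ hL n hn hnL => ((hcl L β hβ hL).1 n hn hnL).1) hφ hU

/-- **The bare-coupling (Gaussian) law kills C′.** If for one faithful `r` of one `SU(n)`, `n ≥ 2`,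
the diagonal femto amplitudes obey `(m+1)⁸ Cov_{8(m+1),β}(m+1) ≤ K β⁻²` for all `m` and `β ≥ β₁`
(covariance = bare coupling squared × kernel squared, NO running), then `FemtoCurvatureTwoPointC`
is false. (For `SU(n)` this hypothesis contradicts asymptotic freedom and is not expected; for the
typed predecessor the corresponding template is empty — compact `U(1)` obeys the law and passes.) -/
theorem femtoCurvatureTwoPointC_false_of_bareLaw_su {n : ℕ} (hn : 2 ≤ n)
    (r : LatticeRep (Matrix.specialUnitaryGroup (Fin n) ℂ)) {K β₁ : ℝ}
    (hK : letI : MeasurableSpace (Matrix.specialUnitaryGroup (Fin n) ℂ) := borel _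
      haveI : BorelSpace (Matrix.specialUnitaryGroup (Fin n) ℂ) := ⟨rfl⟩
      ∀ (m : ℕ) (β : ℝ), β₁ ≤ β →
        ((m + 1 : ℕ) : ℝ) ^ 8 *
          (wilsonExpectation (d := 4) (L := 8 * (m + 1)) r.ρ β (fun U =>
              ((r.N : ℝ) - (r.ρ (plaquetteHolonomy U
                (0 : Site 4 (8 * (m + 1))) 0 1)).trace.re) *
                ((r.N : ℝ) - (r.ρ (plaquetteHolonomy U (Pi.single (2 : Fin 4)
                  (((m + 1 : ℕ) : ℕ) : ZMod (8 * (m + 1)))) 0 1)).trace.re)) -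
            wilsonExpectation (d := 4) (L := 8 * (m + 1)) r.ρ β (fun U =>
                (r.N : ℝ) - (r.ρ (plaquetteHolonomy U (0 : Site 4 (8 * (m + 1))) 0 1)).trace.re) *
              wilsonExpectation (d := 4) (L := 8 * (m + 1)) r.ρ β (fun U => (r.N : ℝ) -
                (r.ρ (plaquetteHolonomy U (Pi.single (2 : Fin 4)
                  (((m + 1 : ℕ) : ℕ) : ZMod (8 * (m + 1)))) 0 1)).trace.re)) ≤ K / β ^ 2) :
    ¬ FemtoCurvatureTwoPointC :=
  femtoCurvatureTwoPointC_false_of_uniformFreezing (isCompactSimpleLieGroup_su hn) r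
    (tendsto_const_nhds.div_atTop (tendsto_pow_atTop two_ne_zero)) hK

end Summit.QuantumFields.YangMills.Theorems.FemtoCurvatureTwoPointC.Negative.UniformFreezing

end
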